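import Summits.Ventures.HodgeRepro.BallSubmersion

/-!
# Rank at one point ⇒ the image is a set of uniqueness for entire functions (seat p5; Mathlib only)

Blind re-derivation cell `pub-hodge-repro`, seat `p5`.  The GLOBAL half of ROUTE-C 13.3(iv) «rank ⇒ dominance»
(R5 step (4)), in the form it takes on the universal cover.  Let `f̃ = (f̃₁, …, f̃_g) : 𝔹^p → ℂ^g` be analytic
with `rank df̃_z = g` at ONE point `z` — in the cell's vocabulary (`BallSubmersion.lean`): the `g` differential
covectors `dcov (f̃_l) z` are linearly independent, which is what `lemmaW_iter` / `lemmaW_generic` /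
`exists_submersion_on_dense` produce for the pulled-back eigenforms.  Then `f̃(𝔹^p)` contains a non-empty
open subset of `ℂ^g` (`BallSubmersion.image_mem_nhds_of_linearIndependent_dcov`), and by the identity theorem
on the connected space `ℂ^g` (Mathlib `AnalyticOnNhd.eqOn_zero_of_preconnected_of_eventuallyEq_zero`) every
entire function `H : ℂ^g → ℂ` vanishing on `f̃(𝔹^p)` vanishes identically.

Reading for the route: for `A′ = ℂ^g / Λ` the lift of `f : S′ → A′` to the universal covers is such an `f̃`
(its coordinates are the integrals of the pulled-back invariant `1`-forms), and every effective divisor of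
`A′` is the zero locus of a theta function — an entire, `Λ`-quasi-periodic function on `ℂ^g`.  So `f(S′)` is
contained in NO divisor of `A′`, hence in no proper closed subvariety (a proper closed subvariety of the
projective variety `A′` lies in a hypersurface section): `f(S′)` is Zariski dense, `f` is dominant.  What stays
on paper is exactly that last textbook sentence (and 13.2(a)); the analysis is here.

* `eq_zero_of_eventuallyEq_zero` — identity theorem on `ℂ^g`: an entire function vanishing on a neighbourhood
  of one point is `0`; `eq_zero_of_eqOn_of_mem_nhds` the set form (`S ∈ 𝓝 w₀`, `H = 0` on `S`);
  `eqOn_zero_of_eqOn_of_mem_nhds` the same for `H` analytic on a preconnected set `V`;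
* `eq_zero_of_eqOn_image_of_mem_nhds` — `f '' U ∈ 𝓝 w₀` and `H ∘ f = 0` on `U` ⇒ `H = 0`;
* `eq_zero_of_eqOn_image_of_linearIndependent_rows` / `…_dcov` — the rank forms: `f` (resp. `(h₁, …, h_g)`)
  analytic at `z` with independent row / differential covectors, `H` entire vanishing on the image of a
  neighbourhood `U` of `z` ⇒ `H = 0`;
* `exists_ne_zero_on_image_of_linearIndependent_dcov`, `not_image_subset_zeroSet_of_linearIndependent_dcov` —
  the dominance forms: a non-zero entire `H` is non-zero somewhere on `(h₁, …, h_g)(U)`; the image lies in the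
  zero set of no non-zero entire function.

Nothing here says anything about the status of the Hodge conjecture for CM abelian varieties.
-/

set_option autoImplicit false

noncomputable section

namespace HodgeRepro.BallGen

namespace Dom

open Filter Topology Subm

variable {g : ℕ}

/-! ### The identity theorem on `ℂ^g` -/

/-- **Identity theorem on `ℂ^g`.**  An entire function `H : ℂ^g → ℂ` that vanishes on a neighbourhood of one
point vanishes identically (`ℂ^g` is connected). -/
theorem eq_zero_of_eventuallyEq_zero {H : (Fin g → ℂ) → ℂ} (hH : AnalyticOnNhd ℂ H Set.univ)
    {w₀ : Fin g → ℂ} (h0 : H =ᶠ[𝓝 w₀] 0) : H = 0 :=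
  funext fun w =>
    hH.eqOn_zero_of_preconnected_of_eventuallyEq_zero isPreconnected_univ (Set.mem_univ w₀) h0
      (Set.mem_univ w)

/-- A function analytic on a preconnected set `V` that vanishes on a set `S` which is a neighbourhood of a
point `w₀ ∈ V` vanishes on all of `V`. -/
theorem eqOn_zero_of_eqOn_of_mem_nhds {H : (Fin g → ℂ) → ℂ} {V : Set (Fin g → ℂ)}
    (hH : AnalyticOnNhd ℂ H V) (hV : IsPreconnected V) {w₀ : Fin g → ℂ} (hw₀ : w₀ ∈ V)
    {S : Set (Fin g → ℂ)} (hS : S ∈ 𝓝 w₀) (h0 : ∀ w ∈ S, H w = 0) : Set.EqOn H 0 V :=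
  hH.eqOn_zero_of_preconnected_of_eventuallyEq_zero hV hw₀ (eventually_of_mem hS h0)

/-- **A set that is a neighbourhood of one of its points is a set of uniqueness for entire functions**: an
entire `H` vanishing on `S ∈ 𝓝 w₀` is `0`. -/
theorem eq_zero_of_eqOn_of_mem_nhds {H : (Fin g → ℂ) → ℂ} (hH : AnalyticOnNhd ℂ H Set.univ)
    {w₀ : Fin g → ℂ} {S : Set (Fin g → ℂ)} (hS : S ∈ 𝓝 w₀) (h0 : ∀ w ∈ S, H w = 0) : H = 0 :=
  eq_zero_of_eventuallyEq_zero hH (eventually_of_mem hS h0)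

/-! ### Images that are neighbourhoods -/

/-- If `f '' U` is a neighbourhood of some point and the entire function `H` vanishes on `f '' U`, then
`H = 0`. -/
theorem eq_zero_of_eqOn_image_of_mem_nhds {p : ℕ} {f : (Fin p → ℂ) → (Fin g → ℂ)} {U : Set (Fin p → ℂ)}
    {w₀ : Fin g → ℂ} (hU : f '' U ∈ 𝓝 w₀) {H : (Fin g → ℂ) → ℂ} (hH : AnalyticOnNhd ℂ H Set.univ)
    (h0 : ∀ w ∈ U, H (f w) = 0) : H = 0 :=
  eq_zero_of_eqOn_of_mem_nhds hH hU (by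
    rintro _ ⟨w, hw, rfl⟩
    exact h0 w hw)

/-- **Rank `g` at one point ⇒ the image of any neighbourhood is a set of uniqueness.**  If `f : ℂ^p → ℂ^g` is
analytic at `z` with the `g` row covectors of `df_z` linearly independent, `U ∈ 𝓝 z`, and the entire function
`H` vanishes on `f '' U`, then `H = 0`. -/
theorem eq_zero_of_eqOn_image_of_linearIndependent_rows {p : ℕ} {f : (Fin p → ℂ) → (Fin g → ℂ)}
    {z : Fin p → ℂ} (hf : AnalyticAt ℂ f z)
    (h : LinearIndependent ℂ (rowCov (fderiv ℂ f z : (Fin p → ℂ) →ₗ[ℂ] (Fin g → ℂ))))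
    {U : Set (Fin p → ℂ)} (hU : U ∈ 𝓝 z) {H : (Fin g → ℂ) → ℂ} (hH : AnalyticOnNhd ℂ H Set.univ)
    (h0 : ∀ w ∈ U, H (f w) = 0) : H = 0 :=
  eq_zero_of_eqOn_image_of_mem_nhds (image_mem_nhds_of_linearIndependent_rows hf h hU) hH h0

/-- The `g`-functions form: `h₁, …, h_g` analytic at `z` with independent differential covectors
`dcov (h l) z`, `U ∈ 𝓝 z`, and an entire `H` with `H (h₁ w, …, h_g w) = 0` for all `w ∈ U` ⇒ `H = 0`. -/
theorem eq_zero_of_eqOn_image_of_linearIndependent_dcov {p : ℕ} (h : Fin g → (Fin p → ℂ) → ℂ)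
    {z : Fin p → ℂ} (ha : ∀ l, AnalyticAt ℂ (h l) z) (hli : LinearIndependent ℂ fun l => dcov (h l) z)
    {U : Set (Fin p → ℂ)} (hU : U ∈ 𝓝 z) {H : (Fin g → ℂ) → ℂ} (hH : AnalyticOnNhd ℂ H Set.univ)
    (h0 : ∀ w ∈ U, H (fun l => h l w) = 0) : H = 0 :=
  eq_zero_of_eqOn_image_of_mem_nhds (image_mem_nhds_of_linearIndependent_dcov h ha hli hU) hH h0

/-! ### Dominance forms -/

/-- **Dominance at the level of functions.**  Under the hypotheses of
`eq_zero_of_eqOn_image_of_linearIndependent_dcov`, a NON-zero entire `H` is non-zero at some point of the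
image `(h₁, …, h_g)(U)`. -/
theorem exists_ne_zero_on_image_of_linearIndependent_dcov {p : ℕ} (h : Fin g → (Fin p → ℂ) → ℂ)
    {z : Fin p → ℂ} (ha : ∀ l, AnalyticAt ℂ (h l) z) (hli : LinearIndependent ℂ fun l => dcov (h l) z)
    {U : Set (Fin p → ℂ)} (hU : U ∈ 𝓝 z) {H : (Fin g → ℂ) → ℂ} (hH : AnalyticOnNhd ℂ H Set.univ)
    (hH0 : H ≠ 0) : ∃ w ∈ U, H (fun l => h l w) ≠ 0 := by
  by_contra hcon
  exact hH0 (eq_zero_of_eqOn_image_of_linearIndependent_dcov h ha hli hU hH fun w hw =>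
    not_not.mp fun hne => hcon ⟨w, hw, hne⟩)

/-- **The image lies in the zero set of no non-zero entire function** — for `A′ = ℂ^g / Λ`: in no divisor
(zero locus of a theta function) of `A′`. -/
theorem not_image_subset_zeroSet_of_linearIndependent_dcov {p : ℕ} (h : Fin g → (Fin p → ℂ) → ℂ)
    {z : Fin p → ℂ} (ha : ∀ l, AnalyticAt ℂ (h l) z) (hli : LinearIndependent ℂ fun l => dcov (h l) z)
    {U : Set (Fin p → ℂ)} (hU : U ∈ 𝓝 z) {H : (Fin g → ℂ) → ℂ} (hH : AnalyticOnNhd ℂ H Set.univ)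
    (hH0 : H ≠ 0) : ¬ ((fun w l => h l w) '' U ⊆ {w | H w = 0}) := by
  intro hsub
  obtain ⟨w, hw, hne⟩ := exists_ne_zero_on_image_of_linearIndependent_dcov h ha hli hU hH hH0
  exact hne (hsub ⟨w, hw, rfl⟩)

end Dom

end HodgeRepro.BallGen

end
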